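import Literature.NumberTheory.Automorphic.CDTTheorem712
import Literature.NumberTheory.EllipticCurves.ModFiveCongruenceHesseFamily
import Literature.NumberTheory.EllipticCurves.GlobalMinimalModel
import Literature.NumberTheory.EllipticCurves.GlobalMinimalModelProofs
import Literature.NumberTheory.EllipticCurves.LeadingTermBSZOrdinaryProofs
import Literature.NumberTheory.EllipticCurves.CongruentNumberCurveJacobiSums
import Literature.NumberTheory.EllipticCurves.WeilPairingProofs
import Literature.NumberTheory.EllipticCurves.VariableChangePoints
import Literature.NumberTheory.EllipticCurves.TorsionFrobeniusChebotarevProofs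
import Literature.NumberTheory.EllipticCurves.TorsionFrobeniusProofs
import Literature.NumberTheory.EllipticCurves.HasseWeilGoodReductionFrobeniusProofs
import Literature.NumberTheory.EllipticCurves.GoodReductionUnramifiedProofs
import Literature.NumberTheory.EllipticCurves.LFunctionPrimeCoeff
import Literature.NumberTheory.EllipticCurves.MinimalModelReduction
import Literature.NumberTheory.EllipticCurves.SupersingularDensitySerreTraceProofs
import Literature.NumberTheory.EllipticCurves.ModPIrreducibleCongruenceTransferProofs
import Literature.NumberTheory.EllipticCurves.FrobeniusTateModuleTraceProofs
import Literature.NumberTheory.EllipticCurves.SemistableModPImageFiveProofs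
import Literature.NumberTheory.GaloisRepresentations.QuarticTwistEulerFactors
import Literature.NumberTheory.GaloisRepresentations.AbsGaloisGroup
import Literature.NumberTheory.GaloisRepresentations.IntegralGaloisActionProofs
import Literature.NumberTheory.EllipticCurves.DivisionField
import Mathlib.NumberTheory.LSeries.PrimesInAP
import HarnessLib

/-!
# stub-ideation k1 (GEN 6, FAMILY 1 — recognise & import) for `stub_switch` = `CDT_three_five_switch`

Companion of `STUB-IDEAS-stub_switch-1.md` (gen 6).  **The `k_v`-road.**  Gen 5 (k1) ran the whole
finite-field side over `ZMod ℓ`, which forced ONE `L−` helper, H6 = "global Frobenius scalar on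
`E♭[5]` ⇒ `ℓ`-Frobenius scalar on `Ẽ♭[5]` over `𝔽_ℓ`", whose part (c) (transport of Galois modules
along `k̄_v ≃ 𝔽̄_ℓ`, uniqueness of Frobenius) has no tree template, and an `M` helper H3 (order-4 case
⇒ `5 ∣ a_ℓ`, via global minimal models and `frobeniusTrace_eq_of_smul_eq_shortWeierstrass`).
Gen 6 observes that NOTHING on the finite-field side needs the field to be `ZMod ℓ`:

* run the anchor (H4), the congruence criteria (H5), Fisher 13.2 (ii) (N2″ — Fisher works over ANY
  perfect field of characteristic `∤ 30`, [Fisher2012Hessian] §2 first sentence + Thm 13.2) and the root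
  extraction (H7′) over the RESIDUE FIELD `k_v = IsLocalRing.ResidueField (v.adicCompletionIntegers ℚ)`
  of the place `v ∣ ℓ` — the field over which the tree's `W.reductionAt v` and its PROVED reduction map
  `exists_reduceTorsionHom` (Silverman VII.3.1(b)) live;
* the bridge is then ONE `M−` lemma **R1** `exists_reductionTorsionEquiv`: an additive isomorphism
  `W[5] ≃+ Ẽ_v[5]` carrying an arithmetic Frobenius `φ` at ANY `𝔓 ∣ v` to the `q_v`-Frobenius — whose
  proof is the tree's PROVED `exists_frobenius_smul_eq_of_dvd_reductionPointCount_holds`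
  (`TorsionFrobeniusProofs` l.274–396) read as a construction: `exists_reduceTorsionHom` +
  `exists_eq_of_injective_of_card_torsionBy_le` + `card_torsionPoints_eq_sq_holds` (bijectivity by
  counting `25 = 25`) + `isArithFrobAt_resGalOfEmb` + `exists_smul_eq_of_mem_primesAbove_holds` +
  `IsArithFrobAt.conj/mul_inv_mem_inertia` + `smul_eq_of_mem_inertia_of_nsmul_eq_zero` (inertia at a
  good `v ∤ 5` acts trivially on `E[5]`);
* R1 serves ALL THREE cases of the trichotomy (`ρ̄(σ) = 1`, `−1`, `ρ̄(σ)² = −1`) verbatim, so H3, the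
  `trace` function and global minimal models disappear from the road: the order-4 case is matched with
  the anchor at the level of GALOIS MODULES (H5a′ `directCongrFive_of_sq_eq_neg`), exactly like the
  scalar case (H5b);
* only the OUTPUT — a root `t̄ ∈ k_v` of Fisher's `𝔠₆(c₄,c₆;·,1)` off `𝔠₄ = 0` — is moved to `ZMod ℓ`,
  along the tree's ring isomorphism `k_v ≃+* ZMod ℓ` (`LFunctionPrimeCoeff` l.318: `ResidueField.mapEquiv
  (padicIntEquiv v) ≫ PadicInt.residueField`), a polynomial identity (T, XS) — landing in gen-5's
  interface `RootSupply c₄ c₆` UNCHANGED, hence in gen-5's kernel-checked assembly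
  `stub_switch_of_rootSupply` (copied verbatim in §6 so that this file is kernel-checked end to end).

H1 (inertial switch element), H2 (Chebotarev), H7′, the objects and `RootSupply` are gen-5's, restated
(crux-dir modules are not importable).  `lean check`: sorries ONLY in helper statements; the bridge
composition `reduction_bridge_baseF`, the CORE `rootSupply_of_kvRoad`, and the ASSEMBLY
`stub_switch_of_rootSupply` / `stub_switch_of_kvRoad` are kernel-checked.
-/

set_option linter.dupNamespace false

namespace Summit.ABC.ABC.Cruxes.FreyModularity.StubSwitchK1G6

open Literature.NumberTheory.EllipticCurves Literature.NumberTheory.EllipticCurves.HesseFamilyFive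
open Literature.NumberTheory.EllipticCurves.BSZLemma17
open Literature.NumberTheory.Automorphic Literature.NumberTheory.GaloisRepresentations
open Literature.NumberTheory.Automorphic.BCDT WeierstrassCurve Field NumberField IsDedekindDomain
open IsDedekindDomain.HeightOneSpectrum

noncomputable section

universe u

/-! ## §0 Objects (verbatim from k1-g5 / k3-g4; crux-dir modules are not importable) -/

/-- Fisher's base model `E : y² = x³ − 27c₄x − 54c₆` over a field. -/
abbrev baseF {F : Type u} [Field F] (c₄ c₆ : F) : WeierstrassCurve F := ⟨0, 0, 0, -27 * c₄, -54 * c₆⟩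

/-- The Hesse member `E_{l,m}` (tree polynomials `HesseFamilyFive.C4/C6`). -/
abbrev memberF {F : Type u} [Field F] (c₄ c₆ l m : F) : WeierstrassCurve F :=
  ⟨0, 0, 0, -27 * C4 c₄ c₆ l m, -54 * C6 c₄ c₆ l m⟩

/-- k3's `ℚ`-objects. -/
abbrev member (c₄ c₆ l m : ℚ) : WeierstrassCurve ℚ := ⟨0, 0, 0, -27 * C4 c₄ c₆ l m, -54 * C6 c₄ c₆ l m⟩
/-- k3's `c₄c₆`-model over `ℚ`. -/
abbrev base (c₄ c₆ : ℚ) : WeierstrassCurve ℚ := ⟨0, 0, 0, -27 * c₄, -54 * c₆⟩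

/-- Direct `5`-congruence over a field ([Fisher2012Hessian] Def. 13.1). -/
def DirectCongrFive {F : Type u} [Field F] (W₁ W₂ : WeierstrassCurve F) [W₁.IsElliptic] [W₂.IsElliptic]
    (h5 : ((5 : ℕ) : F) ≠ 0) : Prop :=
  ∃ e : W₁.geomTorsion 5 ≃+ W₂.geomTorsion 5,
    (∀ (σ : absoluteGaloisGroup F) (P : W₁.geomTorsion 5), e (σ • P) = σ • e P) ∧
    ∀ P Q : W₁.geomTorsion 5,
      weilPairingFun h5 ((e P : W₂.geomTorsion 5) : W₂.geomPoints) ((e Q : W₂.geomTorsion 5) : W₂.geomPoints)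
        = weilPairingFun h5 (P : W₁.geomPoints) (Q : W₁.geomPoints)

/-- **N2″ (named fact, the field-agnostic form of k1-g5's N2′ / k3's N2): Fisher 2012 Thm 13.2 (ii) over a
PERFECT field of characteristic `∤ 30`** ("We work over a perfect field `K` of characteristic not dividing
`6n`", [Fisher2012Hessian] §2; Thm 13.2: `E'` directly `5`-congruent to `E : y² = x³ − 27c₄x − 54c₆` is
`K`-isomorphic to some `E_{λ,μ}`).  Finite fields are perfect (Mathlib `PerfectField.ofFinite`).
TYPING CAVEAT (found in gen 6): the tree's `HesseFamilyFive.C4 = −Hess(𝔇)/17424`, `17424 = 2⁴·3²·11²`, and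
`C6 = (…)/240` are FIELD divisions, so in characteristic `11` they are the junk value `0` and `memberF ≡ y² = x³`
is singular — the fact must ALSO exclude characteristic `11` (`(11 : F) ≠ 0`); gen-5's N2′ (`7 ≤ q`) admits
`q = 11` and is false there as typed (`E' := E`, identity congruence).  Harmless for the road: `ℓ ≡ 41 (60)`.
[Fisher2012Hessian, §2 + Thm 13.2] -/
def Thm132iiPerfect : Prop :=
  ∀ (F : Type) [Field F] [PerfectField F], (30 : F) ≠ 0 → (11 : F) ≠ 0 → ∀ (h5 : ((5 : ℕ) : F) ≠ 0)
    (E E' : WeierstrassCurve F) [E.IsElliptic] [E'.IsElliptic] (c₄ c₆ : F),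
    E = baseF c₄ c₆ → DirectCongrFive E E' h5 →
      ∃ (l m : F) (C : VariableChange F), C • E' = memberF c₄ c₆ l m

/-- The typing caveat, KERNEL-CHECKED: in characteristic `11` the tree's `𝔠₄`, `𝔠₆` vanish identically
(junk division by `17424 = 2⁴3²11²`), so `memberF c₄ c₆ l m` is the cusp `y² = x³` and no elliptic curve is
isomorphic to a member — any "Fisher (ii)" typed over the tree's `C4/C6` without `(11 : F) ≠ 0` is false. -/
example {F : Type} [Field F] [CharP F 11] (c₄ c₆ l m : F) : C4 c₄ c₆ l m = 0 ∧ C6 c₄ c₆ l m = 0 := by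
  have h : (17424 : F) = 0 := by
    have := (CharP.cast_eq_zero_iff F 11 17424).mpr (by norm_num)
    simpa using this
  simp [C6, C4l, C4m, C4, h]

/-- F2 (k1 gen-2 atom, shared with k3): the order-8 Frobenius certificate at `3`. -/
def FrobeniusCertificate : Prop :=
  ∀ (W : WeierstrassCurve ℚ) [W.IsElliptic] [W.IsGloballyMinimal] (q : ℕ) [Fact q.Prime],
    q % 3 = 2 → W.HasGoodReductionAtPrime q → ¬ (3 : ℤ) ∣ W.frobeniusTrace q →
    ∀ ρ₃ : ModPGaloisRep ℚ (ZMod 3) 2, W.IsTorsionGaloisRep 3 ρ₃ → ρ₃.IsAbsIrreducibleOverSqrt (-3)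

/-- The `j = 1728` anchor over any ring: `y² = x³ + a x`. -/
abbrev anchor {R : Type} [CommRing R] (a : R) : WeierstrassCurve R := ⟨0, 0, 0, a, 0⟩

/-! ## §1 The interface (gen 5, UNCHANGED): what the kernel-checked assembly of §6 consumes -/

/-- **RootSupply** (k1-g5 l.108 verbatim). -/
def RootSupply (c₄ c₆ : ℤ) : Prop :=
  ∀ S : Finset ℕ, ∃ (ℓ : ℕ) (_ : Fact ℓ.Prime), ℓ ∉ S ∧ ℓ % 12 = 5 ∧
    ∃ t : ℤ, C6 (c₄ : ZMod ℓ) (c₆ : ZMod ℓ) (t : ZMod ℓ) 1 = 0 ∧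
      C4 (c₄ : ZMod ℓ) (c₆ : ZMod ℓ) (t : ZMod ℓ) 1 ≠ 0

/-! ## §2 Global helpers (gen 5, restated: H1, H2; XS facts) -/

/-- **H1 (M, gen-5 k1 l.147 verbatim) — the inertial switch element.** -/
theorem exists_inertialSwitchElement (W : WeierstrassCurve ℚ) [W.IsElliptic] :
    ∃ σ : absoluteGaloisGroup ℚ,
      (∀ ζ : AlgebraicClosure ℚ, ζ ^ 60 = 1 → σ • ζ = ζ ^ 41) ∧
      ((∀ P : W.geomTorsion 5, σ • P = P) ∨ (∀ P : W.geomTorsion 5, σ • P = -P) ∨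
        (∀ P : W.geomTorsion 5, σ • (σ • P) = -P)) := by
  sorry

/-- **H2 (M, gen-5 k1 l.159 verbatim) — Chebotarev with the cyclotomic side condition.** -/
theorem switchPrime_supply (W : WeierstrassCurve ℚ) [W.IsElliptic] (σ : absoluteGaloisGroup ℚ)
    (hσ : ∀ ζ : AlgebraicClosure ℚ, ζ ^ 60 = 1 → σ • ζ = ζ ^ 41) (S : Set ℕ) (hS : S.Finite) :
    ∃ (ℓ : ℕ) (v : HeightOneSpectrum (𝓞 ℚ)) (𝔓 : Ideal (absIntegers (𝓞 ℚ) ℚ))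
      (φ : absoluteGaloisGroup ℚ),
      ℓ.Prime ∧ ℓ ∉ S ∧ ℓ % 60 = 41 ∧ (ℓ : 𝓞 ℚ) ∈ v.asIdeal ∧ 𝔓 ∈ v.primesAbove ∧
        IsArithFrobAt (𝓞 ℚ) φ 𝔓 ∧ ∀ P : W.geomTorsion 5, φ • P = σ • P := by
  sorry

/-- XS, PROVED (gen 6): the `c₄c₆`-model is elliptic (`Δ = 2⁶3⁹(c₄³ − c₆²)`), via the tree's
`isElliptic_of_ne_zero` for `shortWeierstrass`. -/
theorem isElliptic_base (c₄ c₆ : ℤ) (hc : c₄ ^ 3 ≠ c₆ ^ 2) : (base (c₄ : ℚ) c₆).IsElliptic := by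
  have hbase : base (c₄ : ℚ) c₆ = shortWeierstrass (-27 * c₄, -54 * c₆) := by
    ext <;> simp [shortWeierstrass]
  have hne : 4 * (-27 * c₄, -54 * c₆).1 ^ 3 + 27 * (-27 * c₄, -54 * c₆).2 ^ 2 ≠ 0 := by
    intro h
    have h' : 4 * (-27 * c₄) ^ 3 + 27 * (-54 * c₆) ^ 2 = 0 := h
    have h3 : (78732 : ℤ) * (c₆ ^ 2 - c₄ ^ 3) = 0 := by linear_combination h'
    rcases mul_eq_zero.mp h3 with h4 | h4
    · norm_num at h4
    · exact hc (by linarith)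
  rw [hbase]; exact isElliptic_of_ne_zero hne

/-- PROVED (k1-g3): a nonzero integer of absolute value below `q` is not divisible by `q`. -/
theorem not_dvd_of_natAbs_lt {q : ℕ} {z : ℤ} (hz : z ≠ 0) (hlt : z.natAbs < q) : ¬ (q : ℤ) ∣ z := by
  intro h
  have h1 : q ∣ z.natAbs := by
    rcases h with ⟨k, hk⟩
    exact ⟨k.natAbs, by rw [hk, Int.natAbs_mul, Int.natAbs_natCast]⟩
  exact absurd (Nat.le_of_dvd (Int.natAbs_pos.mpr hz) h1) (not_le.mpr hlt)

/-- PROVED: the rational prime under `v` is `ℓ` once `ℓ ∈ v`, so a different prime is not in `v`. -/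
theorem natCast_not_mem_of_ne {v : HeightOneSpectrum (𝓞 ℚ)} {ℓ p : ℕ} (hℓ : ℓ.Prime) (hp : p.Prime)
    (hℓv : (ℓ : 𝓞 ℚ) ∈ v.asIdeal) (hne : p ≠ ℓ) : (p : 𝓞 ℚ) ∉ v.asIdeal := fun h =>
  hne ((primesEquiv_eq_of_natCast_mem hp h).symm.trans (primesEquiv_eq_of_natCast_mem hℓ hℓv))

/-! ## §3 The bridge at the residue field `k_v` (NEW in gen 6; replaces gen-5 H6 (L−) and H3 (M)) -/

section Bridge

/-- Notation-free abbreviation for the residue field `k_v` of `ℚ_v`. -/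
abbrev kv (v : HeightOneSpectrum (𝓞 ℚ)) : Type := IsLocalRing.ResidueField (v.adicCompletionIntegers ℚ)

/-- **R1 (M−, NEW) — Frobenius-equivariant reduction isomorphism on `5`-torsion.**  For `E/ℚ` with good
reduction at `v ∤ 5`, an arithmetic Frobenius `φ` at ANY prime `𝔓 ∣ v` of `\bar ℤ` and the `q_v`-Frobenius
`frob ∈ Γ_{k_v}`: an additive isomorphism `f : E[5] ≃+ Ẽ_v[5]` with `f (φ P) = frob (f P)`.
PROOF = the tree's PROVED `exists_frobenius_smul_eq_of_dvd_reductionPointCount_holds` (TorsionFrobeniusProofs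
l.274–396) read as a construction: `exists_reduceTorsionHom` (injective `f₀ : E[5^∞] → Ẽ_v(k̄_v)` with
`f₀ (σ₀ P) = frob (f₀ P)`, `σ₀ = resGalOfEmb ι σ_v`), restricted to `E[5]` it is a bijection onto `Ẽ_v[5]`
(`exists_eq_of_injective_of_card_torsionBy_le`, `card_torsionPoints_eq_sq_holds` twice: `25 = 25`);
`σ₀` is a Frobenius at `𝔓₀ = primeBelow ι 𝔐` (`isArithFrobAt_resGalOfEmb`), `τ 𝔓₀ = 𝔓`
(`exists_smul_eq_of_mem_primesAbove_holds`), `γ = τσ₀τ⁻¹` is a Frobenius at `𝔓` (`IsArithFrobAt.conj`),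
`φγ⁻¹ ∈ I_𝔓` (`IsArithFrobAt.mul_inv_mem_inertia`) acts trivially on `E[5]`
(`smul_eq_of_mem_inertia_of_nsmul_eq_zero`); take `f := f₀ ∘ τ⁻¹`. -/
theorem exists_reductionTorsionEquiv (W : WeierstrassCurve ℚ) [W.IsElliptic]
    {v : HeightOneSpectrum (𝓞 ℚ)} (h5v : ((5 : ℕ) : 𝓞 ℚ) ∉ v.asIdeal) (hgood : W.HasGoodReductionAt v)
    {𝔓 : Ideal (absIntegers (𝓞 ℚ) ℚ)} (h𝔓 : 𝔓 ∈ v.primesAbove)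
    {φ : absoluteGaloisGroup ℚ} (hφ : IsArithFrobAt (𝓞 ℚ) φ 𝔓)
    {frob : absoluteGaloisGroup (kv v)} (hfrob : ∀ x : AlgebraicClosure (kv v), frob • x = x ^ Nat.card (kv v)) :
    ∃ f : W.geomTorsion 5 ≃+ (W.reductionAt v).geomTorsion 5,
      ∀ P : W.geomTorsion 5, f (φ • P) = frob • f P := by
  sorry

/-- **GOOD (S)** — the `c₄c₆`-model has good reduction at `v ∣ ℓ`, `ℓ ∤ 30(c₄³ − c₆²)`: it is
`shortWeierstrass (−27c₄, −54c₆)` with `Δ = 2⁶3⁹(c₄³ − c₆²)`; tree PROVED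
`hasGoodReductionAtPrime_shortWeierstrass_of_not_dvd_Δ` + `hasGoodReductionAtPrime_iff_hasGoodReductionAt_ringOfIntegers`
(+ `primesEquiv_eq_of_natCast_mem`). -/
theorem hasGoodReductionAt_base (c₄ c₆ : ℤ) {ℓ : ℕ} [Fact ℓ.Prime]
    (hℓ : ¬ (ℓ : ℤ) ∣ 30 * (c₄ ^ 3 - c₆ ^ 2)) {v : HeightOneSpectrum (𝓞 ℚ)} (hℓv : (ℓ : 𝓞 ℚ) ∈ v.asIdeal) :
    (base (c₄ : ℚ) c₆).HasGoodReductionAt v := by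
  sorry

/-- **ISO (S/M−)** — the reduction `Ẽ♭_v` of the tree (reduction of Mathlib's chosen `𝒪_v`-minimal model)
is `k_v`-isomorphic to the naive reduction `baseF c̄₄ c̄₆`: both `(base c₄ c₆) ⊗ ℚ_v` and
`localMinimalModel v` are `𝒪_v`-integral with unit discriminant, so they differ by an `𝒪_v`-integral change
of variables with unit `u` (Silverman VII.1.3(b); tree section "Two minimal equations differ by an integral
change of variables" of `MinimalModelReduction`, `integralModel_adicCompletion_eq`, pattern of PROVED
`natCard_point_reduction_minimal`); reduce that change of variables. -/
theorem exists_variableChange_reductionAt_base (c₄ c₆ : ℤ) {ℓ : ℕ} [Fact ℓ.Prime]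
    (hℓ : ¬ (ℓ : ℤ) ∣ 30 * (c₄ ^ 3 - c₆ ^ 2)) {v : HeightOneSpectrum (𝓞 ℚ)} (hℓv : (ℓ : 𝓞 ℚ) ∈ v.asIdeal) :
    ∃ C : VariableChange (kv v),
      C • (base (c₄ : ℚ) c₆).reductionAt v = baseF ((c₄ : ℤ) : kv v) ((c₆ : ℤ) : kv v) := by
  sorry

/-- **VC (XS)** — a change of variables over ANY field is an equivariant isomorphism of `n`-torsion
(= tree PROVED `exists_geomTorsion_addEquiv_smul`, stated there for `ℚ`; same proof via `geomPointsEquiv`). -/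
theorem exists_geomTorsion_addEquiv_of_smul_eq {k : Type} [Field k] {V₁ V₂ : WeierstrassCurve k}
    (C : VariableChange k) (h : C • V₁ = V₂) (n : ℤ) :
    ∃ e : V₁.geomTorsion n ≃+ V₂.geomTorsion n,
      ∀ (σ : absoluteGaloisGroup k) (P : V₁.geomTorsion n), e (σ • P) = σ • e P := by
  sorry

/-- **XS, PROVED** — `#k_v = ℓ` (tree `natCard_residueField_adicCompletionIntegers` + `primesEquiv_eq_of_natCast_mem`). -/
theorem natCard_kv {ℓ : ℕ} (hℓ : ℓ.Prime) {v : HeightOneSpectrum (𝓞 ℚ)} (hℓv : (ℓ : 𝓞 ℚ) ∈ v.asIdeal) :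
    Nat.card (kv v) = ℓ := by
  rw [← primesEquiv_eq_of_natCast_mem hℓ hℓv]
  exact natCard_residueField_adicCompletionIntegers v

/-- **T₀ (XS, PROVED)** — the residue field of `ℚ_v`, `v ∣ ℓ`, is `ZMod ℓ` as a ring (Mathlib `padicIntEquiv`,
`PadicInt.residueField`, `ZMod.ringEquivCongr` + tree `primesEquiv_eq_of_natCast_mem`; cf. `LFunctionPrimeCoeff` l.216). -/
theorem nonempty_kv_ringEquiv_zmod {ℓ : ℕ} (hℓ : ℓ.Prime) {v : HeightOneSpectrum (𝓞 ℚ)}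
    (hℓv : (ℓ : 𝓞 ℚ) ∈ v.asIdeal) : Nonempty (kv v ≃+* ZMod ℓ) := by
  haveI := Fact.mk (Rat.HeightOneSpectrum.primesEquiv v).2
  exact ⟨((IsLocalRing.ResidueField.mapEquiv
      (Rat.HeightOneSpectrum.adicCompletionIntegers.padicIntEquiv v).toAlgEquiv.toRingEquiv).trans
      (PadicInt.residueField (p := (Rat.HeightOneSpectrum.primesEquiv v : ℕ)))).trans
      (ZMod.ringEquivCongr (primesEquiv_eq_of_natCast_mem hℓ hℓv))⟩

/-- **T (XS, PROVED)** — Fisher's Hesse polynomials commute with ring homomorphisms of fields (they are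
polynomial expressions in `c₄, c₆, l, m` with field divisions by `17424`, `240`; `map_div₀`). -/
theorem C4_C6_map {R S : Type} [Field R] [Field S] (g : R →+* S) (c₄ c₆ l m : R) :
    g (C4 c₄ c₆ l m) = C4 (g c₄) (g c₆) (g l) (g m) ∧ g (C6 c₄ c₆ l m) = C6 (g c₄) (g c₆) (g l) (g m) := by
  simp only [C4, C6, C4l, C4m, Dl, Dm, Dll, Dlm, Dmm, Dlll, Dllm, Dlmm, Dmmm, map_div₀, map_neg,
    map_sub, map_mul, map_add, map_pow, map_ofNat, and_self]

/-- **The bridge for `E♭ = base c₄ c₆`, PROVED from R1 + GOOD + ISO + VC**: an additive isomorphism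
`E♭[5] ≃+ (baseF c̄₄ c̄₆)[5]` over `k_v` carrying the arithmetic Frobenius `φ` to the `q_v`-Frobenius. -/
theorem reduction_bridge_baseF (c₄ c₆ : ℤ) [(base (c₄ : ℚ) c₆).IsElliptic] {ℓ : ℕ} [hℓp : Fact ℓ.Prime]
    (hℓ : ¬ (ℓ : ℤ) ∣ 30 * (c₄ ^ 3 - c₆ ^ 2)) {v : HeightOneSpectrum (𝓞 ℚ)} (hℓv : (ℓ : 𝓞 ℚ) ∈ v.asIdeal)
    {𝔓 : Ideal (absIntegers (𝓞 ℚ) ℚ)} (h𝔓 : 𝔓 ∈ v.primesAbove)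
    {φ : absoluteGaloisGroup ℚ} (hφ : IsArithFrobAt (𝓞 ℚ) φ 𝔓)
    {frob : absoluteGaloisGroup (kv v)} (hfrob : ∀ x : AlgebraicClosure (kv v), frob • x = x ^ Nat.card (kv v)) :
    ∃ (_ : (baseF ((c₄ : ℤ) : kv v) ((c₆ : ℤ) : kv v)).IsElliptic)
      (f : (base (c₄ : ℚ) c₆).geomTorsion 5 ≃+ (baseF ((c₄ : ℤ) : kv v) ((c₆ : ℤ) : kv v)).geomTorsion 5),
      ∀ P : (base (c₄ : ℚ) c₆).geomTorsion 5, f (φ • P) = frob • f P := by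
  have h5ℓ : (5 : ℕ) ≠ ℓ := by
    rintro rfl
    exact hℓ (dvd_mul_of_dvd_left (by norm_num) _)
  have h5v : ((5 : ℕ) : 𝓞 ℚ) ∉ v.asIdeal := natCast_not_mem_of_ne hℓp.out (by norm_num) hℓv h5ℓ
  have hgood := hasGoodReductionAt_base c₄ c₆ hℓ hℓv
  obtain ⟨f, hf⟩ := exists_reductionTorsionEquiv (base (c₄ : ℚ) c₆) h5v hgood h𝔓 hφ hfrob
  obtain ⟨C, hC⟩ := exists_variableChange_reductionAt_base c₄ c₆ hℓ hℓv
  obtain ⟨e, he⟩ := exists_geomTorsion_addEquiv_of_smul_eq C hC 5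
  haveI : ((base (c₄ : ℚ) c₆).reductionAt v).IsElliptic := isElliptic_reductionAt hgood
  have hEk : (baseF ((c₄ : ℤ) : kv v) ((c₆ : ℤ) : kv v)).IsElliptic := by rw [← hC]; infer_instance
  exact ⟨hEk, f.trans e, fun P => by rw [AddEquiv.trans_apply, AddEquiv.trans_apply, hf, he]⟩

end Bridge

/-! ## §4 The finite-field side over an ARBITRARY finite field `k` (gen-5 H4/H5/H7′ re-typed; proofs unchanged:
point counts move along `ZMod ℓ ≃+* k` by tree PROVED `natCard_point_map_ringEquiv`) -/

section FiniteField

variable (k : Type) [Field k] [Finite k]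

/-- **H4a′ (S/M) — the anchor with Frobenius of square `−1` on `5`-torsion.**  `#k ≡ 1 (20)`: Gauss's count
(tree PROVED `IrelandRosen1990_card_points_one_mod_four_holds`, transported from `ZMod ℓ` along `ZMod.ringEquivOfPrime`
by `natCard_point_map_ringEquiv`) gives a quartic twist `y² = x³ + a x` with `a_k ≡ 0 (mod 5)` (`#k = a′² + b′²`
forces `5 ∣ a′b′`); then Cayley–Hamilton on `A[5]` (`frob² − a·frob + #k = 0`, tree
`trace_galoisRepTate_frobenius_holds` / `galoisRepTate_frobenius_sq_sub_smul_add_smul_eq_zero`) with `#k ≡ 1 (5)`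
gives `frob² = −1`.  No eigenline argument needed in this case. -/
theorem anchor_sq_eq_neg (hk : Nat.card k % 20 = 1)
    {frob : absoluteGaloisGroup k} (hfrob : ∀ x : AlgebraicClosure k, frob • x = x ^ Nat.card k) :
    ∃ (a : k) (_ : (anchor a).IsElliptic), a ≠ 0 ∧
      ∀ P : (anchor a).geomTorsion 5, frob • (frob • P) = -P := by
  sorry

/-- **H4b′ (M, = gen-5 H4b over `k`) — the anchor with SCALAR Frobenius `ε = ±1` on `5`-torsion.**  A twist with
`a_k ≡ 2ε (mod 5)` exists (Gauss, as in H4a′), and its Frobenius is semisimple on `A[5]`: it commutes with the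
`k`-rational automorphism `[i] : (x,y) ↦ (−x, ιy)` (`ι² = −1 ∈ k`, a `VariableChange` automorphism of the model),
whose eigenlines `A[[i] − 2], A[[i] + 2]` split `A[5]` (`[i]` is not a scalar on `A[5]`: it preserves the Weil
pairing while a scalar `±2` would square it); `x + y = 2ε`, `xy = 1` force `x = y = ε`. -/
theorem anchor_scalar (hk : Nat.card k % 20 = 1) (ε : ℤ) (hε : ε = 1 ∨ ε = -1)
    {frob : absoluteGaloisGroup k} (hfrob : ∀ x : AlgebraicClosure k, frob • x = x ^ Nat.card k) :
    ∃ (a : k) (_ : (anchor a).IsElliptic), a ≠ 0 ∧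
      ∀ P : (anchor a).geomTorsion 5, frob • P = ε • P := by
  sorry

/-- **H5a′ (M−, NEW form of gen-5 H5a) — the order-4 criterion at the level of Galois modules.**  If the
`#k`-Frobenius has square `−1` on both `V[5]` and `V'[5]` and `#k ≡ 1 (5)` (so `det = 1` by the Weil pairing,
`weilPairingFun` equivariance + `frob ζ₅ = ζ₅`), then both act with the separable characteristic polynomial
`X² + 1 = (X − 2)(X − 3)` over `𝔽₅`, i.e. diagonally with eigenvalues `2, 3` on the eigenlines; map eigenline to
eigenline (`Γ_k` acts through `frob`: every `τ ∈ Γ_k` acts on `V[5]` as a power of `frob`, the image of the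
procyclic `Γ_k` being generated by the image of `frob`) and rescale one eigenvector to make the isomorphism
symplectic (`e₅(eP, eQ) = e₅(P, Q)^{det e}`). -/
theorem directCongrFive_of_sq_eq_neg (h5 : ((5 : ℕ) : k) ≠ 0) (hk : Nat.card k % 5 = 1)
    (V V' : WeierstrassCurve k) [V.IsElliptic] [V'.IsElliptic]
    {frob : absoluteGaloisGroup k} (hfrob : ∀ x : AlgebraicClosure k, frob • x = x ^ Nat.card k)
    (hV : ∀ P : V.geomTorsion 5, frob • (frob • P) = -P)
    (hV' : ∀ P : V'.geomTorsion 5, frob • (frob • P) = -P) : DirectCongrFive V V' h5 := by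
  sorry

/-- **H5b (S/M−, gen-5 H5b over `k`) — the scalar criterion.**  If the `#k`-Frobenius is the same scalar `ε` on
`V[5]` and `V'[5]`, then every `τ ∈ Γ_k` acts on both as `ε^{n(τ)}`, so ANY additive isomorphism is
equivariant; choose it symplectic (tree PROVED `exists_weilPairing_holds` / `weilPairingFun_*`). -/
theorem directCongrFive_of_scalar (h5 : ((5 : ℕ) : k) ≠ 0)
    (V V' : WeierstrassCurve k) [V.IsElliptic] [V'.IsElliptic]
    {frob : absoluteGaloisGroup k} (hfrob : ∀ x : AlgebraicClosure k, frob • x = x ^ Nat.card k)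
    (ε : ℤ) (hV : ∀ P : V.geomTorsion 5, frob • P = ε • P)
    (hV' : ∀ P : V'.geomTorsion 5, frob • P = ε • P) : DirectCongrFive V V' h5 := by
  sorry

end FiniteField

/-- **H7′ (S, gen-5 H7′ over any field of characteristic `∤ 30`) — root extraction from membership of a
`j = 1728` curve.**  `C • (y² = x³ + a x) = E_{l,m}` (`a ≠ 0`, `c₆ ≠ 0`): `c₆ = 0` is an isomorphism
invariant up to `u⁻⁶`, so `𝔠₆(l,m) = 0`, `𝔠₄(l,m) ≠ 0` (nonsingular); `m ≠ 0` (else `𝔠₆(l,0) = c₆ l³⁰`, tree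
`C6_one_zero`, and `l = 0` would make `E_{0,0}` singular); `t := l/m` by homogeneity (degrees `20`, `30`). -/
theorem root_of_member_anchor {k : Type} [Field k] (h30 : (30 : k) ≠ 0) (c₄ c₆ l m a : k)
    (hc₆ : c₆ ≠ 0) (ha : a ≠ 0) (C : VariableChange k) (h : C • anchor a = memberF c₄ c₆ l m) :
    ∃ t : k, C6 c₄ c₆ t 1 = 0 ∧ C4 c₄ c₆ t 1 ≠ 0 := by
  sorry

/-! ## §5 The CORE, kernel-checked: H1 + H2 + bridge + H4′/H5′ + N2″ + H7′ + T ⇒ `RootSupply` -/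

/-- **The core of the `k_v`-road (PROVED from the helpers + the named fact).**  `S ↦ S ∪ [0, |30c₆(c₄³−c₆²)|]`;
H1 on `E♭`; H2; the bridge `reduction_bridge_baseF` moves the trichotomy to `(baseF c̄₄ c̄₆)[5]` over `k_v`
VERBATIM; order `4` ⇒ H4a′ + H5a′; scalar `ε` ⇒ H4b′ + H5b; then Fisher (ii) over the perfect field `k_v`,
H7′, and the root is carried to `ZMod ℓ` along `k_v ≃+* ZMod ℓ` (T₀ + T). -/
theorem rootSupply_of_kvRoad (hFii : Thm132iiPerfect) (c₄ c₆ : ℤ) (hc : c₄ ^ 3 ≠ c₆ ^ 2)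
    (hc₆ : c₆ ≠ 0) : RootSupply c₄ c₆ := by
  intro S
  haveI hE : (base (c₄ : ℚ) c₆).IsElliptic := isElliptic_base c₄ c₆ hc
  -- the bad integer and the enlarged finite set
  set z : ℤ := 30 * c₆ * (c₄ ^ 3 - c₆ ^ 2) with hz
  have hz0 : z ≠ 0 := mul_ne_zero (mul_ne_zero (by norm_num) hc₆) (sub_ne_zero.mpr hc)
  set S' : Finset ℕ := S ∪ Finset.range (z.natAbs + 1) with hS'
  -- H1, H2
  obtain ⟨σ, hσζ, hσ⟩ := exists_inertialSwitchElement (base (c₄ : ℚ) c₆)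
  obtain ⟨ℓ, v, 𝔓, φ, hℓp, hℓS', h60, hℓv, h𝔓, hφ, hact⟩ :=
    switchPrime_supply (base (c₄ : ℚ) c₆) σ hσζ (↑S') S'.finite_toSet
  haveI : Fact ℓ.Prime := ⟨hℓp⟩
  have hℓS : ℓ ∉ S := fun h => hℓS' (Finset.mem_coe.mpr (Finset.mem_union_left _ h))
  have hℓgt : z.natAbs < ℓ := by
    by_contra hle
    exact hℓS' (Finset.mem_coe.mpr (Finset.mem_union_right _ (Finset.mem_range.mpr (by omega))))
  have hℓz : ¬ (ℓ : ℤ) ∣ z := not_dvd_of_natAbs_lt hz0 hℓgt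
  have hℓ30 : ¬ (ℓ : ℤ) ∣ 30 * (c₄ ^ 3 - c₆ ^ 2) := fun h => hℓz (by
    rw [hz, show (30 : ℤ) * c₆ * (c₄ ^ 3 - c₆ ^ 2) = c₆ * (30 * (c₄ ^ 3 - c₆ ^ 2)) by ring]
    exact dvd_mul_of_dvd_right h _)
  have hℓc₆ : ¬ (ℓ : ℤ) ∣ c₆ := fun h => hℓz (by
    rw [hz, show (30 : ℤ) * c₆ * (c₄ ^ 3 - c₆ ^ 2) = c₆ * (30 * (c₄ ^ 3 - c₆ ^ 2)) by ring]
    exact dvd_mul_of_dvd_left h _)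
  have h12 : ℓ % 12 = 5 := by omega
  -- the residue field `k_v`: `#k_v = ℓ`, `k_v ≃+* ZMod ℓ`, `30 ≠ 0`, `5 ≠ 0`, `c̄₆ ≠ 0`
  have hcard : Nat.card (kv v) = ℓ := natCard_kv hℓp hℓv
  have h20 : Nat.card (kv v) % 20 = 1 := by rw [hcard]; omega
  have hk5 : Nat.card (kv v) % 5 = 1 := by rw [hcard]; omega
  obtain ⟨g⟩ := nonempty_kv_ringEquiv_zmod hℓp hℓv
  have hcast : ∀ n : ℤ, (n : kv v) = 0 ↔ (ℓ : ℤ) ∣ n := fun n => by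
    rw [← ZMod.intCast_zmod_eq_zero_iff_dvd, ← map_intCast (g : kv v →+* ZMod ℓ) n]
    exact (map_eq_zero_iff _ g.injective).symm
  have h30 : (30 : kv v) ≠ 0 := by
    have h := (hcast 30).not.mpr (fun h => hℓ30 (dvd_mul_of_dvd_left h _))
    exact_mod_cast h
  have h5 : ((5 : ℕ) : kv v) ≠ 0 := by
    have h := (hcast 5).not.mpr (fun h => hℓ30 (dvd_mul_of_dvd_left (h.trans (by norm_num)) _))
    exact_mod_cast h
  have hc₆' : ((c₆ : ℤ) : kv v) ≠ 0 := (hcast c₆).not.mpr hℓc₆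
  have h11 : (11 : kv v) ≠ 0 := by
    have h := (hcast 11).not.mpr (fun h => by
      have h' : ℓ ∣ 11 := Int.natCast_dvd_natCast.mp h
      have := Nat.le_of_dvd (by norm_num) h'
      omega)
    exact_mod_cast h
  obtain ⟨frob, hfrob⟩ := exists_frobenius_absoluteGaloisGroup (kv v)
  -- the bridge: the trichotomy, now on `(baseF c̄₄ c̄₆)[5]` over `k_v`
  obtain ⟨hEk, f, hf⟩ := reduction_bridge_baseF c₄ c₆ hℓ30 hℓv h𝔓 hφ hfrob
  haveI := hEk
  have hsurj : ∀ Q : (baseF ((c₄ : ℤ) : kv v) ((c₆ : ℤ) : kv v)).geomTorsion 5,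
      ∃ P : (base (c₄ : ℚ) c₆).geomTorsion 5, f P = Q := fun Q => ⟨f.symm Q, f.apply_symm_apply Q⟩
  -- the anchor, directly 5-congruent to `Ẽ♭`, in each of the three cases
  have hanchor : ∃ (a : kv v) (_ : (anchor a).IsElliptic), a ≠ 0 ∧
      DirectCongrFive (baseF ((c₄ : ℤ) : kv v) ((c₆ : ℤ) : kv v)) (anchor a) h5 := by
    rcases hσ with hσ | hσ | hσ
    · -- scalar `+1`
      have hred : ∀ Q : (baseF ((c₄ : ℤ) : kv v) ((c₆ : ℤ) : kv v)).geomTorsion 5,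
          frob • Q = (1 : ℤ) • Q := fun Q => by
        obtain ⟨P, rfl⟩ := hsurj Q
        rw [one_zsmul, ← hf, hact P, hσ P]
      obtain ⟨a, hael, ha, hV'⟩ := anchor_scalar (kv v) h20 1 (Or.inl rfl) hfrob
      exact ⟨a, hael, ha, directCongrFive_of_scalar (kv v) h5 _ _ hfrob 1 hred hV'⟩
    · -- scalar `−1`
      have hred : ∀ Q : (baseF ((c₄ : ℤ) : kv v) ((c₆ : ℤ) : kv v)).geomTorsion 5,
          frob • Q = (-1 : ℤ) • Q := fun Q => by
        obtain ⟨P, rfl⟩ := hsurj Q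
        rw [neg_one_zsmul, ← hf, hact P, hσ P, map_neg]
      obtain ⟨a, hael, ha, hV'⟩ := anchor_scalar (kv v) h20 (-1) (Or.inr rfl) hfrob
      exact ⟨a, hael, ha, directCongrFive_of_scalar (kv v) h5 _ _ hfrob (-1) hred hV'⟩
    · -- order `4`, matched at the level of Galois modules (no trace, no minimal model)
      have hsq : ∀ Q : (baseF ((c₄ : ℤ) : kv v) ((c₆ : ℤ) : kv v)).geomTorsion 5,
          frob • (frob • Q) = -Q := fun Q => by
        obtain ⟨P, rfl⟩ := hsurj Q
        rw [← hf, ← hf, hact P, hact (σ • P), hσ P, map_neg]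
      obtain ⟨a, hael, ha, hV'⟩ := anchor_sq_eq_neg (kv v) h20 hfrob
      exact ⟨a, hael, ha, directCongrFive_of_sq_eq_neg (kv v) h5 hk5 _ _ hfrob hsq hV'⟩
  obtain ⟨a, hael, ha, hcongr⟩ := hanchor
  haveI := hael
  -- Fisher (ii) over the perfect field `k_v`, root extraction, transport to `ZMod ℓ`
  obtain ⟨l, m, C, hC⟩ := hFii (kv v) h30 h11 h5 (baseF ((c₄ : ℤ) : kv v) ((c₆ : ℤ) : kv v)) (anchor a)
    ((c₄ : ℤ) : kv v) ((c₆ : ℤ) : kv v) rfl hcongr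
  obtain ⟨t, ht6, ht4⟩ := root_of_member_anchor h30 _ _ l m a hc₆' ha C hC
  obtain ⟨hg4, hg6⟩ := C4_C6_map (g : kv v →+* ZMod ℓ) ((c₄ : ℤ) : kv v) ((c₆ : ℤ) : kv v) t 1
  simp only [map_intCast, map_one, RingHom.coe_coe] at hg4 hg6
  refine ⟨ℓ, ⟨hℓp⟩, hℓS, h12, ((g t).val : ℤ), ?_, ?_⟩
  · have : C6 (c₄ : ZMod ℓ) (c₆ : ZMod ℓ) (g t) 1 = 0 := by rw [← hg6, ht6, map_zero]
    simpa [ZMod.natCast_zmod_val] using this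
  · have : C4 (c₄ : ZMod ℓ) (c₆ : ZMod ℓ) (g t) 1 ≠ 0 := by
      rw [← hg4]; exact fun h0 => ht4 (g.injective (by rw [h0, map_zero]))
    simpa [ZMod.natCast_zmod_val] using this

/-! ## §6 The TAIL and the ASSEMBLY (gen 5 §6 VERBATIM: `stub_switch_of_rootSupply` is kernel-checked) -/

/-- PROVED (gen 1): transport of a framed `5`-torsion model along a `5`-congruence. -/
theorem isTorsionGaloisRep_of_congr {W W' : WeierstrassCurve ℚ} (h : Congr W' W)
    {ρ : ModPGaloisRep ℚ (ZMod 5) 2} (hρ : W.IsTorsionGaloisRep 5 ρ) :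
    W'.IsTorsionGaloisRep 5 ρ := by
  obtain ⟨e', he'⟩ := h
  obtain ⟨e, he⟩ := hρ
  refine ⟨e'.trans e, fun σ P => ?_⟩
  rw [AddEquiv.trans_apply, AddEquiv.trans_apply, he', he]

/-- G2 (S, k3-g4 verbatim): the member has an integral short model read off `𝔠₄, 𝔠₆ (mod ℓ)`. -/
theorem member_integral_short_mod (ℓ : ℕ) [Fact ℓ.Prime] (hℓ : ℓ ∉ ({2, 3, 5, 11} : Finset ℕ))
    (c₄ c₆ t : ℤ) :
    ∃ (A B : ℤ) (Cv : VariableChange ℚ),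
      Cv • member c₄ c₆ t 1 = shortWeierstrass (A, B) ∧
      ((A : ZMod ℓ) = 0 ↔ C4 (c₄ : ZMod ℓ) (c₆ : ZMod ℓ) (t : ZMod ℓ) 1 = 0) ∧
      ((B : ZMod ℓ) = 0 ↔ C6 (c₄ : ZMod ℓ) (c₆ : ZMod ℓ) (t : ZMod ℓ) 1 = 0) := by
  sorry

/-- G6a (XS, k3 verbatim): an integral rescaling of `(c₄, c₆)`. -/
theorem exists_integral_scaling (x y : ℚ) :
    ∃ (u : ℤ) (c₄ c₆ : ℤ), u ≠ 0 ∧ (c₄ : ℚ) = (u : ℚ) ^ 4 * x ∧ (c₆ : ℚ) = (u : ℚ) ^ 6 * y := by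
  sorry

/-- G6b (XS, k3 verbatim): the rescaled `c₄c₆`-model is isomorphic to `W`. -/
theorem base_scaled (W : WeierstrassCurve ℚ) [W.IsElliptic] {u c₄ c₆ : ℤ} (hu : u ≠ 0)
    (h4 : (c₄ : ℚ) = (u : ℚ) ^ 4 * W.c₄) (h6 : (c₆ : ℚ) = (u : ℚ) ^ 6 * W.c₆) :
    ∃ Cv : VariableChange ℚ, Cv • W = base c₄ c₆ := by
  sorry

/-- G6c (PROVED, Dirichlet). -/
theorem exists_prime_five_mod_twelve_gt (n : ℕ) : ∃ ℓ : ℕ, ℓ.Prime ∧ n < ℓ ∧ ℓ % 12 = 5 := by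
  have h5 : IsUnit ((5 : ℕ) : ZMod 12) := by decide
  obtain ⟨ℓ, hgt, hp, hmod⟩ := Nat.forall_exists_prime_gt_and_eq_mod h5 n
  refine ⟨ℓ, hp, hgt, ?_⟩
  have := (ZMod.natCast_eq_natCast_iff' ℓ 5 12).1 hmod
  simpa using this

/-- **`tail` (k3-g4 §4, PROVED THERE, kernel-checked; restated as a helper here).** -/
theorem tail (hF2 : FrobeniusCertificate) (W : WeierstrassCurve ℚ) [W.IsElliptic] (A B : ℤ)
    [(shortWeierstrass (A, B)).IsElliptic] (hEW : Congr (shortWeierstrass (A, B)) W)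
    (ℓ : ℕ) [Fact ℓ.Prime] (h12 : ℓ % 12 = 5) (hA : ¬ (ℓ : ℤ) ∣ A) (hB : (ℓ : ℤ) ∣ B)
    (ρ : ModPGaloisRep ℚ (ZMod 5) 2) (hρ : W.IsTorsionGaloisRep 5 ρ) :
    ∃ (W' : WeierstrassCurve ℚ) (_ : W'.IsElliptic), W'.IsTorsionGaloisRep 5 ρ ∧
      ∃ ρ₃' : ModPGaloisRep ℚ (ZMod 3) 2, W'.IsTorsionGaloisRep 3 ρ₃' ∧
        ρ₃'.IsAbsIrreducibleOverSqrt (-3) := by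
  sorry

/-- **Fisher (i) + RootSupply + F2 ⇒ the stub** (gen-5 k1 `stub_switch_of_rootSupply`, verbatim, kernel-checked). -/
theorem stub_switch_of_rootSupply (hF : thm132_geomTorsionFive_of_hesseFamily)
    (hRoot : ∀ c₄ c₆ : ℤ, c₄ ^ 3 ≠ c₆ ^ 2 → c₆ ≠ 0 → RootSupply c₄ c₆)
    (hF2 : FrobeniusCertificate) : CDT_three_five_switch := by
  intro W _ _ _ ρ hρ _
  obtain ⟨u, c₄, c₆, hu, h4, h6⟩ := exists_integral_scaling W.c₄ W.c₆
  obtain ⟨Cv, hCv⟩ := base_scaled W hu h4 h6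
  haveI hBell : (base (c₄ : ℚ) c₆).IsElliptic := by rw [← hCv]; infer_instance
  have hcongrB : Congr (base (c₄ : ℚ) c₆) W := congr_symm (congr_of_smul_eq Cv hCv)
  have hcQ : (c₄ : ℚ) ^ 3 ≠ (c₆ : ℚ) ^ 2 := by
    intro h
    have h1728 : (1728 : ℚ) * (base (c₄ : ℚ) c₆).Δ =
        (base (c₄ : ℚ) c₆).c₄ ^ 3 - (base (c₄ : ℚ) c₆).c₆ ^ 2 := (base (c₄ : ℚ) c₆).c_relation
    have hc4 : (base (c₄ : ℚ) c₆).c₄ = 6 ^ 4 * c₄ := by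
      simp only [WeierstrassCurve.c₄, WeierstrassCurve.b₂, WeierstrassCurve.b₄]; ring
    have hc6 : (base (c₄ : ℚ) c₆).c₆ = 6 ^ 6 * c₆ := by
      simp only [WeierstrassCurve.c₆, WeierstrassCurve.b₂, WeierstrassCurve.b₄, WeierstrassCurve.b₆]; ring
    rw [hc4, hc6, mul_pow, mul_pow, h, show ((6 : ℚ) ^ 4) ^ 3 = (6 ^ 6) ^ 2 by norm_num, ← sub_mul,
      sub_self, zero_mul] at h1728
    exact (base (c₄ : ℚ) c₆).isUnit_Δ.ne_zero (by simpa using h1728)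
  have hc : c₄ ^ 3 ≠ c₆ ^ 2 := fun h => hcQ (by exact_mod_cast h)
  by_cases hc₆ : c₆ = 0
  · -- `j(W) = 1728`: `W♭ = E_{−27c₄, 0}` itself
    subst hc₆
    have hc₄ : c₄ ≠ 0 := by rintro rfl; exact hc (by norm_num)
    have hz : (-27 * c₄ : ℤ) ≠ 0 := by omega
    obtain ⟨ℓ, hℓ, hgt, h12⟩ := exists_prime_five_mod_twelve_gt (-27 * c₄).natAbs
    haveI : Fact ℓ.Prime := ⟨hℓ⟩
    have hbase : base (c₄ : ℚ) ((0 : ℤ) : ℚ) = shortWeierstrass (-27 * c₄, 0) := by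
      ext <;> simp [shortWeierstrass]
    haveI : (shortWeierstrass (-27 * c₄, 0)).IsElliptic := by rw [← hbase]; exact hBell
    have hcongrE : Congr (shortWeierstrass (-27 * c₄, 0)) W := by rw [← hbase]; exact hcongrB
    exact tail hF2 W (-27 * c₄) 0 hcongrE ℓ h12 (not_dvd_of_natAbs_lt hz hgt) (dvd_zero _) ρ hρ
  · -- generic case: RootSupply at a prime `ℓ ≡ 5 (12)` outside `{2,3,5,11}`
    obtain ⟨ℓ, hℓF, hℓS, h12, t, ht6', ht4'⟩ := hRoot c₄ c₆ hc hc₆ {2, 3, 5, 11}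
    haveI := hℓF
    obtain ⟨A, B, Cv', hCv', hA4, hB6⟩ := member_integral_short_mod ℓ hℓS c₄ c₆ t
    have hA : ¬ (ℓ : ℤ) ∣ A := by
      rw [← ZMod.intCast_zmod_eq_zero_iff_dvd, hA4]; exact ht4'
    have hB : (ℓ : ℤ) ∣ B := by
      rw [← ZMod.intCast_zmod_eq_zero_iff_dvd, hB6]; exact ht6'
    have hℓ1 : ℓ % 4 = 1 := by omega
    have h2 : (2 : ZMod ℓ) ≠ 0 := GaussianQuartic.two_ne_zero_of_one_mod_four hℓ1
    have hA' : (A : ZMod ℓ) ≠ 0 := by rwa [Ne, ZMod.intCast_zmod_eq_zero_iff_dvd]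
    have hB' : (B : ZMod ℓ) = 0 := by rwa [ZMod.intCast_zmod_eq_zero_iff_dvd]
    have hne : 4 * (A, B).1 ^ 3 + 27 * (A, B).2 ^ 2 ≠ 0 := by
      intro h0
      have h0' := congrArg (Int.cast : ℤ → ZMod ℓ) h0
      push_cast at h0'
      rw [hB'] at h0'
      have : (4 : ZMod ℓ) * (A : ZMod ℓ) ^ 3 + 27 * (0 : ZMod ℓ) ^ 2 = 2 ^ 2 * (A : ZMod ℓ) ^ 3 := by ring
      rw [this] at h0'
      exact mul_ne_zero (pow_ne_zero _ h2) (pow_ne_zero _ hA') h0'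
    haveI hEell : (shortWeierstrass (A, B)).IsElliptic := isElliptic_of_ne_zero hne
    set E' : WeierstrassCurve ℚ := member c₄ c₆ t 1 with hE'
    haveI hE'ell : E'.IsElliptic := by
      have : E' = Cv'⁻¹ • shortWeierstrass (A, B) := by rw [← hCv', inv_smul_smul]
      rw [this]; infer_instance
    obtain ⟨e, he⟩ := hF (base (c₄ : ℚ) c₆) E' (c₄ : ℚ) (c₆ : ℚ) (t : ℚ) 1 rfl rfl
    have hcongrE : Congr (shortWeierstrass (A, B)) W :=
      congr_trans (congr_symm (congr_of_smul_eq Cv' hCv')) (congr_trans ⟨e, he⟩ hcongrB)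
    exact tail hF2 W A B hcongrE ℓ h12 hA hB ρ hρ

/-- **The whole `k_v`-road in one line: Fisher (i) + Fisher (ii) over perfect fields + F2 (+ the helpers) ⇒ `stub_switch`.** -/
theorem stub_switch_of_kvRoad (hF : thm132_geomTorsionFive_of_hesseFamily)
    (hFii : Thm132iiPerfect) (hF2 : FrobeniusCertificate) : CDT_three_five_switch :=
  stub_switch_of_rootSupply hF (fun c₄ c₆ hc hc₆ => rootSupply_of_kvRoad hFii c₄ c₆ hc hc₆) hF2

/-- Sanity: the conclusion is LITERALLY the registered stub's statement (`Iff.rfl` in the skeleton,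
`stub_switch_iff_CDT_three_five_switch`). -/
example (hF : thm132_geomTorsionFive_of_hesseFamily) (hFii : Thm132iiPerfect) (hF2 : FrobeniusCertificate) :
    ∀ (W : WeierstrassCurve ℚ) [W.IsElliptic], ¬ 27 ∣ W.conductorNorm ℤ →
      (∀ ρ₃ : ModPGaloisRep ℚ (ZMod 3) 2, W.IsTorsionGaloisRep 3 ρ₃ → ¬ ρ₃.IsAbsIrreducibleOverSqrt (-3)) →
      ∀ (ρ : ModPGaloisRep ℚ (ZMod 5) 2), W.IsTorsionGaloisRep 5 ρ → ρ.IsAbsIrreducibleOverSqrt 5 →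
        ∃ (W' : WeierstrassCurve ℚ) (_ : W'.IsElliptic), W'.IsTorsionGaloisRep 5 ρ ∧
          ∃ ρ₃' : ModPGaloisRep ℚ (ZMod 3) 2, W'.IsTorsionGaloisRep 3 ρ₃' ∧ ρ₃'.IsAbsIrreducibleOverSqrt (-3) :=
  stub_switch_of_kvRoad hF hFii hF2

end

end Summit.ABC.ABC.Cruxes.FreyModularity.StubSwitchK1G6
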